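import Literature.Analysis.FunctionSpaces.TorusClassicalNSLinearisation
import HarnessLib

/-!
# Dependence of the linearised Navier–Stokes flow on the base trajectory (continuity of the
# Fréchet derivative of the solution map) on `T³`

Function-space support file (all results proved; no definitions, no named facts), sequel of
`TorusClassicalNSLinearisation` (the linearised flow `S'(t, u₁)` is the Fréchet derivative of the
solution map, with a locally uniform quadratic remainder). Here: the derivative depends
Lipschitz-continuously on the base point. For two classical solutions `(u₁, p₁)`, `(u₂, p₂)` on
`[a, a + τ] × T^d` (`card d = 3`, same viscosity `ν > 0` and force, zero-mean slices, `‖u₂‖ ≤ M`,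
`‖∂ᵢu₁‖ ≤ C¹ᵢ`, `‖∂ᵢu₂‖ ≤ C²ᵢ`, `∑ᵢC¹ᵢ, ∑ᵢC²ᵢ ≤ Λ`) and linearised solutions `w₁` along `u₁`, `w₂`
along `u₂` (zero-mean slices) with the SAME datum `w₁(a) = w₂(a) = ξ`:

`∫ ‖(w₂ − w₁)(t)‖² ≤ K · (∫‖δ(a)‖² + ‖∇δ(a)‖₂²) · (∫‖ξ‖² + ‖∇ξ‖₂²)`, `δ = u₂ − u₁`,

with `K = K(ν, M, Λ, τ)` (`Torus.IsClassicalNSSolutionOn.exists_linearisedNS_sub_sq_le`), i.e.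
`‖S'(t, u₂(a)) − S'(t, u₁(a))‖_{V → H} ≤ √K ‖u₂(a) − u₁(a)‖_{H¹}`: the map `u ↦ S'(t, u)` is
Lipschitz from `V` into `L(V, H)`, uniformly over base points obeying the coefficient bounds — the
continuity-of-the-derivative half of "`S(t)` is `C¹`" (Constantin–Foias 1988, Ch. 14,
(14.2)–(14.4) with Lemma 14.3; Temam 1997, Ch. VI (3.12) and §8).

Proof: along `u₁`, `w₂` solves the linearised equation with the source
`g = −(δ·∇)w₂ − (w₂·∇)δ` (`Torus.linearisedNS_rebase`), so `y = w₂ − w₁` solves it with source `g`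
and `y(a) = 0`; both pairings `2|∫⟪(δ·∇)w₂, y⟫|`, `2|∫⟪(w₂·∇)δ, y⟫|` are absorbed by the
dissipation up to `ν⁻¹∫‖δ‖²‖w₂‖² ≤ ν⁻¹‖δ‖²_{L⁴}‖w₂‖²_{L⁴}`
(`Torus.two_mul_abs_integral_inner_convect_le_of_isDivFree`, `Torus.integral_norm_sq_mul_norm_sq_le`),
where `‖δ(s)‖⁴_{L⁴} ≤ K₄‖δ(a)‖⁴_{H¹}` (`….exists_integral_norm_sub_pow_four_le`) and
`‖w₂(s)‖⁴_{L⁴} ≤ K_w‖ξ‖⁴_{H¹}` (`Torus.exists_linearisedNS_integral_norm_pow_four_le`: Ladyzhenskaya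
and the exponential `H¹` bound `Torus.linearisedNS_h1_le_mul_exp`); Grönwall
(`Torus.linearisedNSForced_integral_norm_sq_le`).

## Mathlib / tree search

Tree (`lean search 'linearisedNS_sub_le|rebase|S. prime'`): none beyond the files above; reused:
`Torus.integral_inner_convect_eq_neg`, `Torus.fderiv_apply_eq_sum_partialDeriv`, `Torus.fderiv_sub`,
`Torus.integral_mul_le_sqrt_mul_sqrt_of_continuous`, `Torus.integral_norm_pow_four_le_gradNormSq_sq`,
`Literature.Analysis.FluidPDE.Torus.linearisedNS_h1_le_mul_exp`, `Torus.linearisedNSForced_sub_eq`,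
`Torus.linearisedNSForced_integral_norm_sq_le`. Mathlib: `Real.sum_mul_le_sqrt_mul_sqrt`,
`Real.sqrt_le_sqrt`, `Real.sqrt_mul`, `Real.sqrt_sq`.

## References

* P. Constantin, C. Foias, *Navier–Stokes Equations*, Univ. Chicago Press 1988, Ch. 14,
  (14.2)–(14.4), Lemma 14.3. [`ConstantinFoiasNSE1988`]
* R. Temam, *Infinite-Dimensional Dynamical Systems in Mechanics and Physics*, 2nd ed., Springer
  1997, Ch. VI §3.1 (3.12) and §8 (differentiability of the semigroup). [`Temam1997`]
-/

open MeasureTheory Set Filter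
open scoped InnerProductSpace ContDiff Topology

noncomputable section

namespace Literature.Analysis.FunctionSpaces

namespace Torus

variable {d : Type*} [Fintype d] [DecidableEq d]

/-! ## Pairings absorbed by the dissipation -/

section Spatial

omit [DecidableEq d] in
/-- Young's inequality in the form `2AS ≤ εS² + ε⁻¹A²` (`ε > 0`). [folklore] -/
private theorem two_mul_mul_le_eps {ε A S : ℝ} (hε : 0 < ε) :
    2 * (A * S) ≤ ε * S ^ 2 + ε⁻¹ * A ^ 2 := by
  have hε0 : ε ≠ 0 := hε.ne'
  have key : ε * S ^ 2 + ε⁻¹ * A ^ 2 - 2 * (A * S) = ε⁻¹ * (ε * S - A) ^ 2 := by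
    field_simp
    ring
  have hnn : 0 ≤ ε⁻¹ * (ε * S - A) ^ 2 := by positivity
  linarith

/-- **Trilinear pairings with a divergence-free first slot are absorbed by the dissipation.** For
`ε > 0`, a smooth divergence-free `v : T^d → ℝ^d` and smooth `a, b`,
`2|∫ ⟪(v·∇)a, b⟫| ≤ ε ‖∇b‖₂² + ε⁻¹ ∫ ‖v‖²‖a‖²`: antisymmetry `∫⟪(v·∇)a, b⟫ = −∫⟪a, (v·∇)b⟫`
(`Torus.integral_inner_convect_eq_neg`), `‖(v·∇)b‖ ≤ ‖v‖(∑ᵢ‖∂ᵢb‖²)^{1/2}` pointwise, and Young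
(Temam's `|b(u, v, w)| ≤ |u|_{L⁴}|v|_{L⁴}‖w‖`-type bound, Constantin–Foias 1988, Ch. 6, (6.9)).
[folklore] -/
theorem two_mul_abs_integral_inner_convect_le_of_isDivFree {ε : ℝ} (hε : 0 < ε)
    {v a b : UnitAddTorus d → EuclideanSpace ℝ d} (hv : IsSmooth v) (hdiv : IsDivFree v)
    (ha : IsSmooth a) (hb : IsSmooth b) :
    2 * |∫ x, ⟪convect v a x, b x⟫_ℝ| ≤ ε * gradNormSq b + ε⁻¹ * ∫ x, ‖v x‖ ^ 2 * ‖a x‖ ^ 2 := by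
  rw [integral_inner_convect_eq_neg hv hdiv ha hb, abs_neg]
  have hb1 : IsContDiff 1 b := hb.isContDiff (by simp)
  have hpt : ∀ x, 2 * |⟪a x, convect v b x⟫_ℝ| ≤
      ε * (∑ i, ‖partialDeriv i b x‖ ^ 2) + ε⁻¹ * (‖v x‖ ^ 2 * ‖a x‖ ^ 2) := by
    intro x
    set S : ℝ := Real.sqrt (∑ i, ‖partialDeriv i b x‖ ^ 2) with hS
    have hS2 : S ^ 2 = ∑ i, ‖partialDeriv i b x‖ ^ 2 :=
      Real.sq_sqrt (Finset.sum_nonneg fun i _ => sq_nonneg _)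
    have hconv : convect v b x = ∑ i, v x i • partialDeriv i b x :=
      fderiv_apply_eq_sum_partialDeriv hb1 x (v x)
    have hcv : ‖convect v b x‖ ≤ ‖v x‖ * S := by
      rw [hconv, EuclideanSpace.norm_eq (v x)]
      calc ‖∑ i, v x i • partialDeriv i b x‖ ≤ ∑ i, ‖v x i‖ * ‖partialDeriv i b x‖ :=
            (norm_sum_le _ _).trans (le_of_eq (Finset.sum_congr rfl fun i _ => norm_smul _ _))
        _ ≤ Real.sqrt (∑ i, ‖v x i‖ ^ 2) * S := Real.sum_mul_le_sqrt_mul_sqrt _ _ _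
    have h1 : |⟪a x, convect v b x⟫_ℝ| ≤ (‖v x‖ * ‖a x‖) * S := by
      calc |⟪a x, convect v b x⟫_ℝ| ≤ ‖a x‖ * ‖convect v b x‖ := abs_real_inner_le_norm _ _
        _ ≤ ‖a x‖ * (‖v x‖ * S) := mul_le_mul_of_nonneg_left hcv (norm_nonneg _)
        _ = (‖v x‖ * ‖a x‖) * S := by ring
    have hY := two_mul_mul_le_eps (A := ‖v x‖ * ‖a x‖) (S := S) hε
    calc 2 * |⟪a x, convect v b x⟫_ℝ| ≤ 2 * ((‖v x‖ * ‖a x‖) * S) := by linarith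
      _ ≤ ε * S ^ 2 + ε⁻¹ * (‖v x‖ * ‖a x‖) ^ 2 := hY
      _ = ε * (∑ i, ‖partialDeriv i b x‖ ^ 2) + ε⁻¹ * (‖v x‖ ^ 2 * ‖a x‖ ^ 2) := by
          rw [hS2]; ring
  have hi : Integrable (fun x => |⟪a x, convect v b x⟫_ℝ|) volume :=
    (ha.inner (hv.convect hb)).integrable.abs
  have hiD : Integrable (fun x => ∑ i, ‖partialDeriv i b x‖ ^ 2) volume :=
    integrable_finsetSum _ fun i _ => ((hb.partialDeriv i).norm_sq).integrable
  have hiP : Integrable (fun x => ‖v x‖ ^ 2 * ‖a x‖ ^ 2) volume :=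
    ((hv.continuous.norm.pow 2).mul (ha.continuous.norm.pow 2)).integrable_unitAddTorus
  have hiR : Integrable (fun x => ε * (∑ i, ‖partialDeriv i b x‖ ^ 2) +
      ε⁻¹ * (‖v x‖ ^ 2 * ‖a x‖ ^ 2)) volume := (hiD.const_mul _).add (hiP.const_mul _)
  calc 2 * |∫ x, ⟪a x, convect v b x⟫_ℝ| ≤ 2 * ∫ x, |⟪a x, convect v b x⟫_ℝ| := by
        gcongr
        exact abs_integral_le_integral_abs
    _ = ∫ x, 2 * |⟪a x, convect v b x⟫_ℝ| := (integral_const_mul _ _).symm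
    _ ≤ ∫ x, (ε * (∑ i, ‖partialDeriv i b x‖ ^ 2) + ε⁻¹ * (‖v x‖ ^ 2 * ‖a x‖ ^ 2)) :=
        integral_mono (hi.const_mul 2) hiR hpt
    _ = ε * gradNormSq b + ε⁻¹ * ∫ x, ‖v x‖ ^ 2 * ‖a x‖ ^ 2 := by
        rw [integral_add (hiD.const_mul _) (hiP.const_mul _), integral_const_mul,
          integral_const_mul, gradNormSq]

omit [DecidableEq d] in
/-- **Cauchy–Schwarz for the product of two squares**: `∫ ‖v‖²‖a‖² ≤ (∫‖v‖⁴)^{1/2} (∫‖a‖⁴)^{1/2}`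
for smooth (continuous) fields on `T^d`. [folklore] -/
theorem integral_norm_sq_mul_norm_sq_le {v a : UnitAddTorus d → EuclideanSpace ℝ d}
    (hv : IsSmooth v) (ha : IsSmooth a) :
    ∫ x, ‖v x‖ ^ 2 * ‖a x‖ ^ 2 ≤ Real.sqrt (∫ x, ‖v x‖ ^ 4) * Real.sqrt (∫ x, ‖a x‖ ^ 4) := by
  have hcv : Continuous fun x => ‖v x‖ ^ 2 := hv.continuous.norm.pow 2
  have hca : Continuous fun x => ‖a x‖ ^ 2 := ha.continuous.norm.pow 2
  have h := integral_mul_le_sqrt_mul_sqrt_of_continuous hcv hca (fun x => sq_nonneg _)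
    fun x => sq_nonneg _
  have e1 : ∫ x, (‖v x‖ ^ 2) ^ 2 = ∫ x, ‖v x‖ ^ 4 := integral_congr_ae (ae_of_all _ fun x => by ring)
  have e2 : ∫ x, (‖a x‖ ^ 2) ^ 2 = ∫ x, ‖a x‖ ^ 4 := integral_congr_ae (ae_of_all _ fun x => by ring)
  rwa [e1, e2] at h

end Spatial

/-! ## Rebasing a linearised solution and the `L⁴` bound of the linearised flow -/

section Rebase

variable {a b ν : ℝ} {u₁ u₂ w : ℝ → UnitAddTorus d → EuclideanSpace ℝ d} {q : ℝ → UnitAddTorus d → ℝ}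

omit [DecidableEq d] in
/-- **Rebasing the linearised equation.** If `(w, q)` solves the linearised equation along `u₂` on
`[a, b]` and `u₁` is another jointly smooth field, then along `u₁` it solves the INHOMOGENEOUS
linearised equation with source `−((u₂ − u₁)·∇)w − (w·∇)(u₂ − u₁)`
(`(u₂·∇)w = (u₁·∇)w + (δ·∇)w`, `(w·∇)u₂ = (w·∇)u₁ + (w·∇)δ`). [folklore] -/
theorem linearisedNS_rebase (hu₁ : IsSmoothSpaceTimeOn (Icc a b) u₁)
    (hu₂ : IsSmoothSpaceTimeOn (Icc a b) u₂)
    (hlin : ∀ t ∈ Icc a b, ∀ x, timeDerivWithin (Icc a b) w t x + convect (u₂ t) (w t) x +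
      convect (w t) (u₂ t) x = ν • laplacian (w t) x - gradient (q t) x)
    {t : ℝ} (ht : t ∈ Icc a b) (x : UnitAddTorus d) :
    timeDerivWithin (Icc a b) w t x + convect (u₁ t) (w t) x + convect (w t) (u₁ t) x =
      ν • laplacian (w t) x - gradient (q t) x +
        -(convect (fun y => u₂ t y - u₁ t y) (w t) x + convect (w t) (fun y => u₂ t y - u₁ t y) x) := by
  have h1 : IsContDiff 1 (u₁ t) := (hu₁.isSmooth_slice ht).isContDiff (by simp)
  have h2 : IsContDiff 1 (u₂ t) := (hu₂.isSmooth_slice ht).isContDiff (by simp)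
  have hA : convect (u₂ t) (w t) x = convect (u₁ t) (w t) x +
      convect (fun y => u₂ t y - u₁ t y) (w t) x := by
    simp only [convect]
    rw [← map_add, add_sub_cancel]
  have hB : convect (w t) (u₂ t) x = convect (w t) (u₁ t) x +
      convect (w t) (fun y => u₂ t y - u₁ t y) x := by
    have h12 : (fun y => u₂ t y - u₁ t y) = u₂ t - u₁ t := rfl
    simp only [convect, h12, fderiv_sub h2 h1, sub_apply]
    abel
  have h := hlin t ht x
  rw [hA, hB] at h
  rw [← h]
  abel

end Rebase

section Three

variable {ν M Λ τ : ℝ}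

/-- **`L⁴` bound of the linearised flow on `T³`.** On `T^d` with `card d = 3`, for `ν > 0`,
`Λ ≥ 0`, `τ > 0` and `M` there is `K_w ≥ 0` such that every zero-mean linearised solution `(w, q)`
along a jointly smooth divergence-free `u` on `[a, a + τ]` with `‖u‖ ≤ M`, `‖∂ᵢu‖ ≤ Cᵢ`,
`∑ᵢCᵢ ≤ Λ` obeys `∫ ‖w(t)‖⁴ ≤ K_w (∫‖w(a)‖² + ‖∇w(a)‖₂²)²` on `[a, a + τ]` (Ladyzhenskaya
`Torus.integral_norm_pow_four_le_gradNormSq_sq` and the exponential `H¹` bound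
`Literature.Analysis.FluidPDE.Torus.linearisedNS_h1_le_mul_exp`). [folklore] -/
theorem exists_linearisedNS_integral_norm_pow_four_le (hd : Fintype.card d = 3)
    (hν : 0 < ν) (hΛ : 0 ≤ Λ) (hτ : 0 < τ) (M : ℝ) :
    ∃ K : ℝ, 0 ≤ K ∧ ∀ {a : ℝ} {u w : ℝ → UnitAddTorus d → EuclideanSpace ℝ d}
      {q : ℝ → UnitAddTorus d → ℝ} {C : d → ℝ},
      IsSmoothSpaceTimeOn (Icc a (a + τ)) u → (∀ t ∈ Icc a (a + τ), IsDivFree (u t)) →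
      IsSmoothSpaceTimeOn (Icc a (a + τ)) w → IsSmoothSpaceTimeOn (Icc a (a + τ)) q →
      (∀ t ∈ Icc a (a + τ), IsDivFree (w t)) → (∀ t ∈ Icc a (a + τ), HasZeroMean (w t)) →
      (∀ t ∈ Icc a (a + τ), ∀ x, timeDerivWithin (Icc a (a + τ)) w t x + convect (u t) (w t) x +
        convect (w t) (u t) x = ν • laplacian (w t) x - gradient (q t) x) →
      (∀ t ∈ Icc a (a + τ), ∀ x, ‖u t x‖ ≤ M) →
      (∀ i, ∀ t ∈ Icc a (a + τ), ∀ x, ‖partialDeriv i (u t) x‖ ≤ C i) → ∑ i, C i ≤ Λ →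
      ∀ t ∈ Icc a (a + τ), ∫ x, ‖w t x‖ ^ 4 ≤ K * ((∫ x, ‖w a x‖ ^ 2) + gradNormSq (w a)) ^ 2 := by
  obtain ⟨KL, hKL0, hKL⟩ := integral_norm_pow_four_le_gradNormSq_sq (d := d) hd
  set K₃ : ℝ := 2 * Λ + (Λ ^ 2 + Fintype.card d * M ^ 2) / ν with hK₃
  have hK₃0 : 0 ≤ K₃ := by positivity
  refine ⟨KL * Real.exp (K₃ * τ) ^ 2, by positivity, ?_⟩
  intro a u w q C hu hudiv hw hq hwdiv hwz hlin hM hC hCΛ t ht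
  have ha : a ∈ Icc a (a + τ) := left_mem_Icc.2 (by linarith)
  have hL0 : 0 ≤ ∑ i, C i := Finset.sum_nonneg fun i _ => (norm_nonneg _).trans (hC i a ha 0)
  set Ξ : ℝ := (∫ x, ‖w a x‖ ^ 2) + gradNormSq (w a) with hΞ
  have hΞ0 : 0 ≤ Ξ := add_nonneg (integral_nonneg fun x => sq_nonneg _) (gradNormSq_nonneg _)
  have hH1 := Literature.Analysis.FluidPDE.Torus.linearisedNS_h1_le_mul_exp hν hu hudiv hw hq hwdiv
    hlin hM hC ht
  have hrate : (2 * ∑ i, C i + ((∑ i, C i) ^ 2 + Fintype.card d * M ^ 2) / ν) * (t - a) ≤ K₃ * τ := by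
    have h1 : 2 * ∑ i, C i + ((∑ i, C i) ^ 2 + Fintype.card d * M ^ 2) / ν ≤ K₃ := by
      have hsq : (∑ i, C i) ^ 2 ≤ Λ ^ 2 := pow_le_pow_left₀ hL0 hCΛ 2
      have h2 : ((∑ i, C i) ^ 2 + Fintype.card d * M ^ 2) / ν ≤ (Λ ^ 2 + Fintype.card d * M ^ 2) / ν :=
        div_le_div_of_nonneg_right (by linarith) hν.le
      simp only [hK₃]
      linarith
    have h0 : 0 ≤ 2 * ∑ i, C i + ((∑ i, C i) ^ 2 + Fintype.card d * M ^ 2) / ν := by positivity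
    have ht1 : 0 ≤ t - a := by linarith [ht.1]
    have ht2 : t - a ≤ τ := by linarith [ht.2]
    calc _ ≤ K₃ * (t - a) := mul_le_mul_of_nonneg_right h1 ht1
      _ ≤ K₃ * τ := mul_le_mul_of_nonneg_left ht2 hK₃0
  have hV : gradNormSq (w t) ≤ Ξ * Real.exp (K₃ * τ) := by
    have hE0 : 0 ≤ ∫ x, ‖w t x‖ ^ 2 := integral_nonneg fun x => sq_nonneg _
    calc gradNormSq (w t) ≤ (∫ x, ‖w t x‖ ^ 2) + gradNormSq (w t) := le_add_of_nonneg_left hE0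
      _ ≤ Ξ * Real.exp ((2 * ∑ i, C i + ((∑ i, C i) ^ 2 + Fintype.card d * M ^ 2) / ν) * (t - a)) := hH1
      _ ≤ Ξ * Real.exp (K₃ * τ) := mul_le_mul_of_nonneg_left (Real.exp_le_exp.2 hrate) hΞ0
  have hV0 : 0 ≤ gradNormSq (w t) := gradNormSq_nonneg _
  calc ∫ x, ‖w t x‖ ^ 4 ≤ KL * gradNormSq (w t) ^ 2 := hKL _ (hw.isSmooth_slice ht) (hwz t ht)
    _ ≤ KL * (Ξ * Real.exp (K₃ * τ)) ^ 2 := by gcongr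
    _ = KL * Real.exp (K₃ * τ) ^ 2 * Ξ ^ 2 := by ring

/-- **Lipschitz dependence of the linearised flow on the base trajectory** (continuity of the
Fréchet derivative `u ↦ S'(t, u)` from `V` into `L(V, H)`, locally uniform). On `T^d` with
`card d = 3`, for `ν > 0`, `Λ ≥ 0`, `τ > 0` and `M` there is `K ≥ 0` such that: for two classical
solutions `(u₁, p₁)`, `(u₂, p₂)` on `[a, a + τ] × T^d` (same viscosity `ν` and force) with zero-mean
slices, `‖u₂‖ ≤ M`, `‖∂ᵢu₁‖ ≤ C¹ᵢ`, `‖∂ᵢu₂‖ ≤ C²ᵢ`, `∑ᵢC¹ᵢ ≤ Λ`, `∑ᵢC²ᵢ ≤ Λ`, and linearised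
solutions `(w₁, q₁)` along `u₁`, `(w₂, q₂)` along `u₂` on `[a, a + τ]` (`w₂` with zero-mean slices)
with the same datum `w₁(a) = w₂(a)`, for all `t ∈ [a, a + τ]`:
`∫ ‖w₂(t) − w₁(t)‖² ≤ K (∫‖(u₂ − u₁)(a)‖² + ‖∇(u₂ − u₁)(a)‖₂²) (∫‖w₂(a)‖² + ‖∇w₂(a)‖₂²)`.
[cite: ConstantinFoiasNSE1988, Ch. 14 Lemma 14.3 (14.10)] -/
theorem IsClassicalNSSolutionOn.exists_linearisedNS_sub_sq_le (hd : Fintype.card d = 3)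
    (hν : 0 < ν) (hΛ : 0 ≤ Λ) (hτ : 0 < τ) (M : ℝ) :
    ∃ K : ℝ, 0 ≤ K ∧ ∀ {a : ℝ} {f u₁ u₂ w₁ w₂ : ℝ → UnitAddTorus d → EuclideanSpace ℝ d}
      {p₁ p₂ q₁ q₂ : ℝ → UnitAddTorus d → ℝ} {C₁ C₂ : d → ℝ},
      IsClassicalNSSolutionOn (Icc a (a + τ)) ν f u₁ p₁ →
      IsClassicalNSSolutionOn (Icc a (a + τ)) ν f u₂ p₂ →
      (∀ t ∈ Icc a (a + τ), HasZeroMean (u₁ t)) → (∀ t ∈ Icc a (a + τ), HasZeroMean (u₂ t)) →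
      (∀ t ∈ Icc a (a + τ), ∀ x, ‖u₂ t x‖ ≤ M) →
      (∀ i, ∀ t ∈ Icc a (a + τ), ∀ x, ‖partialDeriv i (u₁ t) x‖ ≤ C₁ i) → ∑ i, C₁ i ≤ Λ →
      (∀ i, ∀ t ∈ Icc a (a + τ), ∀ x, ‖partialDeriv i (u₂ t) x‖ ≤ C₂ i) → ∑ i, C₂ i ≤ Λ →
      IsSmoothSpaceTimeOn (Icc a (a + τ)) w₁ → IsSmoothSpaceTimeOn (Icc a (a + τ)) q₁ →
      (∀ t ∈ Icc a (a + τ), IsDivFree (w₁ t)) →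
      (∀ t ∈ Icc a (a + τ), ∀ x, timeDerivWithin (Icc a (a + τ)) w₁ t x + convect (u₁ t) (w₁ t) x +
        convect (w₁ t) (u₁ t) x = ν • laplacian (w₁ t) x - gradient (q₁ t) x) →
      IsSmoothSpaceTimeOn (Icc a (a + τ)) w₂ → IsSmoothSpaceTimeOn (Icc a (a + τ)) q₂ →
      (∀ t ∈ Icc a (a + τ), IsDivFree (w₂ t)) → (∀ t ∈ Icc a (a + τ), HasZeroMean (w₂ t)) →
      (∀ t ∈ Icc a (a + τ), ∀ x, timeDerivWithin (Icc a (a + τ)) w₂ t x + convect (u₂ t) (w₂ t) x +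
        convect (w₂ t) (u₂ t) x = ν • laplacian (w₂ t) x - gradient (q₂ t) x) →
      w₁ a = w₂ a →
      ∀ t ∈ Icc a (a + τ), ∫ x, ‖w₂ t x - w₁ t x‖ ^ 2 ≤
        K * ((∫ x, ‖u₂ a x - u₁ a x‖ ^ 2) + gradNormSq (fun y => u₂ a y - u₁ a y)) *
          ((∫ x, ‖w₂ a x‖ ^ 2) + gradNormSq (w₂ a)) := by
  obtain ⟨K₄, hK₄0, hK₄⟩ :=
    IsClassicalNSSolutionOn.exists_integral_norm_sub_pow_four_le (d := d) hd hν hΛ hτ M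
  obtain ⟨Kw, hKw0, hKw⟩ := exists_linearisedNS_integral_norm_pow_four_le (d := d) hd hν hΛ hτ M
  refine ⟨ν⁻¹ * (2 * (Real.sqrt K₄ * Real.sqrt Kw)) * τ * Real.exp (2 * Λ * τ), by positivity, ?_⟩
  intro a f u₁ u₂ w₁ w₂ p₁ p₂ q₁ q₂ C₁ C₂ h₁ h₂ hz₁ hz₂ hM₂ hC₁ hC₁Λ hC₂ hC₂Λ hw₁ hq₁ hw₁div hlin₁
    hw₂ hq₂ hw₂div hw₂z hlin₂ h0 t ht
  set b : ℝ := a + τ with hb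
  have hab : a < b := by rw [hb]; linarith
  have ha : a ∈ Icc a b := left_mem_Icc.2 hab.le
  set H₀ : ℝ := (∫ x, ‖u₂ a x - u₁ a x‖ ^ 2) + gradNormSq (fun y => u₂ a y - u₁ a y) with hH₀
  set Ξ : ℝ := (∫ x, ‖w₂ a x‖ ^ 2) + gradNormSq (w₂ a) with hΞ
  have hH₀0 : 0 ≤ H₀ := add_nonneg (integral_nonneg fun x => sq_nonneg _) (gradNormSq_nonneg _)
  have hΞ0 : 0 ≤ Ξ := add_nonneg (integral_nonneg fun x => sq_nonneg _) (gradNormSq_nonneg _)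
  -- the perturbation of the base, the difference of the linearised solutions, its source
  set δ : ℝ → UnitAddTorus d → EuclideanSpace ℝ d := fun s y => u₂ s y - u₁ s y with hδ_def
  set y : ℝ → UnitAddTorus d → EuclideanSpace ℝ d := fun s x => w₂ s x - w₁ s x with hy_def
  set G : ℝ → UnitAddTorus d → EuclideanSpace ℝ d := fun s x =>
    -(convect (δ s) (w₂ s) x + convect (w₂ s) (δ s) x) with hG_def
  set Z : ℝ → UnitAddTorus d → EuclideanSpace ℝ d := fun _ _ => 0 with hZ_def
  have hδ : IsSmoothSpaceTimeOn (Icc a b) δ := h₂.smooth_velocity.sub h₁.smooth_velocity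
  have hy : IsSmoothSpaceTimeOn (Icc a b) y := hw₂.sub hw₁
  have hδdiv : ∀ s ∈ Icc a b, IsDivFree (δ s) := by
    intro s hs x
    have hu₁ : IsSmooth (u₁ s) := h₁.smooth_velocity.isSmooth_slice hs
    have hu₂ : IsSmooth (u₂ s) := h₂.smooth_velocity.isSmooth_slice hs
    have hδ' : δ s = u₂ s - u₁ s := rfl
    rw [hδ', divergence_sub (hu₂.isContDiff (by simp)) (hu₁.isContDiff (by simp)),
      h₂.divFree s hs x, h₁.divFree s hs x, sub_zero]
  have hydiv : ∀ s ∈ Icc a b, IsDivFree (y s) := by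
    intro s hs x
    have hy' : y s = w₂ s - w₁ s := rfl
    rw [hy', divergence_sub ((hw₂.isSmooth_slice hs).isContDiff (by simp))
      ((hw₁.isSmooth_slice hs).isContDiff (by simp)), hw₂div s hs x, hw₁div s hs x, sub_zero]
  have hGZ : ∀ s ∈ Icc a b, IsSmooth (fun x => G s x - Z s x) := by
    intro s hs
    have hδs := hδ.isSmooth_slice hs
    have hws := hw₂.isSmooth_slice hs
    have h : (fun x => G s x - Z s x) = -(fun x => convect (δ s) (w₂ s) x + convect (w₂ s) (δ s) x) := by
      funext x; simp only [hG_def, hZ_def, sub_zero, Pi.neg_apply]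
    rw [h]
    exact ((hδs.convect hws).add (hws.convect hδs)).neg
  -- `w₂` rebased along `u₁`, `w₁` with source `0`, hence `y` with source `G - 0`
  have hlin₂' : ∀ s ∈ Icc a b, ∀ x, timeDerivWithin (Icc a b) w₂ s x + convect (u₁ s) (w₂ s) x +
      convect (w₂ s) (u₁ s) x = ν • laplacian (w₂ s) x - gradient (q₂ s) x + G s x :=
    fun s hs x => linearisedNS_rebase h₁.smooth_velocity h₂.smooth_velocity hlin₂ hs x
  have hlin₁' : ∀ s ∈ Icc a b, ∀ x, timeDerivWithin (Icc a b) w₁ s x + convect (u₁ s) (w₁ s) x +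
      convect (w₁ s) (u₁ s) x = ν • laplacian (w₁ s) x - gradient (q₁ s) x + Z s x := by
    intro s hs x
    rw [hlin₁ s hs x, hZ_def, add_zero]
  have hliny : ∀ s ∈ Icc a b, ∀ x, timeDerivWithin (Icc a b) y s x + convect (u₁ s) (y s) x +
      convect (y s) (u₁ s) x = ν • laplacian (y s) x - gradient (fun z => q₂ s z - q₁ s z) x +
        (G s x - Z s x) :=
    fun s hs x => linearisedNSForced_sub_eq hw₂ hq₂ hlin₂' hw₁ hq₁ hlin₁' hab hs x
  -- `L⁴` bounds of `δ` and `w₂`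
  have hQδ : ∀ s ∈ Icc a b, ∫ x, ‖δ s x‖ ^ 4 ≤ K₄ * H₀ ^ 2 := fun s hs =>
    hK₄ h₁ h₂ hz₁ hz₂ hM₂ hC₁ hC₁Λ s hs
  have hQw : ∀ s ∈ Icc a b, ∫ x, ‖w₂ s x‖ ^ 4 ≤ Kw * Ξ ^ 2 := fun s hs =>
    hKw h₂.smooth_velocity h₂.divFree hw₂ hq₂ hw₂div hw₂z hlin₂ hM₂ hC₂ hC₂Λ s hs
  -- the source is absorbed
  set Gc : ℝ := ν⁻¹ * (2 * (Real.sqrt K₄ * Real.sqrt Kw)) * (H₀ * Ξ) with hGc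
  have hGc0 : 0 ≤ Gc := by positivity
  have hsrc : ∀ s ∈ Icc a b, 2 * ∫ x, ⟪G s x - Z s x, y s x⟫_ℝ ≤
      2 * ν * gradNormSq (y s) + 0 * (∫ x, ‖y s x‖ ^ 2) + Gc := by
    intro s hs
    have hδs : IsSmooth (δ s) := hδ.isSmooth_slice hs
    have hws : IsSmooth (w₂ s) := hw₂.isSmooth_slice hs
    have hys : IsSmooth (y s) := hy.isSmooth_slice hs
    have hA := two_mul_abs_integral_inner_convect_le_of_isDivFree hν hδs (hδdiv s hs) hws hys
    have hB := two_mul_abs_integral_inner_convect_le_of_isDivFree hν hws (hw₂div s hs) hδs hys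
    have hP1 := integral_norm_sq_mul_norm_sq_le hδs hws
    have hP2 := integral_norm_sq_mul_norm_sq_le hws hδs
    have hs1 : Real.sqrt (∫ x, ‖δ s x‖ ^ 4) ≤ Real.sqrt K₄ * H₀ := by
      calc Real.sqrt (∫ x, ‖δ s x‖ ^ 4) ≤ Real.sqrt (K₄ * H₀ ^ 2) := Real.sqrt_le_sqrt (hQδ s hs)
        _ = Real.sqrt K₄ * H₀ := by rw [Real.sqrt_mul hK₄0, Real.sqrt_sq hH₀0]
    have hs2 : Real.sqrt (∫ x, ‖w₂ s x‖ ^ 4) ≤ Real.sqrt Kw * Ξ := by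
      calc Real.sqrt (∫ x, ‖w₂ s x‖ ^ 4) ≤ Real.sqrt (Kw * Ξ ^ 2) := Real.sqrt_le_sqrt (hQw s hs)
        _ = Real.sqrt Kw * Ξ := by rw [Real.sqrt_mul hKw0, Real.sqrt_sq hΞ0]
    have hprod : Real.sqrt (∫ x, ‖δ s x‖ ^ 4) * Real.sqrt (∫ x, ‖w₂ s x‖ ^ 4) ≤
        (Real.sqrt K₄ * H₀) * (Real.sqrt Kw * Ξ) :=
      mul_le_mul hs1 hs2 (Real.sqrt_nonneg _) (by positivity)
    have hP1' : ∫ x, ‖δ s x‖ ^ 2 * ‖w₂ s x‖ ^ 2 ≤ (Real.sqrt K₄ * H₀) * (Real.sqrt Kw * Ξ) :=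
      hP1.trans hprod
    have hP2' : ∫ x, ‖w₂ s x‖ ^ 2 * ‖δ s x‖ ^ 2 ≤ (Real.sqrt K₄ * H₀) * (Real.sqrt Kw * Ξ) := by
      rw [mul_comm] at hprod
      exact hP2.trans hprod
    have hint : ∫ x, ⟪G s x - Z s x, y s x⟫_ℝ = -((∫ x, ⟪convect (δ s) (w₂ s) x, y s x⟫_ℝ) +
        ∫ x, ⟪convect (w₂ s) (δ s) x, y s x⟫_ℝ) := by
      rw [← integral_add (((hδs.convect hws).inner hys).integrable)
        (((hws.convect hδs).inner hys).integrable), ← integral_neg]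
      refine integral_congr_ae (ae_of_all _ fun x => ?_)
      simp only [hG_def, hZ_def, sub_zero, inner_neg_left, inner_add_left]
    rw [hint, zero_mul, add_zero]
    have hν0 : 0 ≤ ν⁻¹ := (inv_pos.2 hν).le
    have hm1 := mul_le_mul_of_nonneg_left hP1' hν0
    have hm2 := mul_le_mul_of_nonneg_left hP2' hν0
    have e : Gc = ν⁻¹ * ((Real.sqrt K₄ * H₀) * (Real.sqrt Kw * Ξ)) +
        ν⁻¹ * ((Real.sqrt K₄ * H₀) * (Real.sqrt Kw * Ξ)) := by simp only [hGc]; ring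
    rw [e]
    have hab1 := neg_abs_le (∫ x, ⟪convect (δ s) (w₂ s) x, y s x⟫_ℝ)
    have hab2 := neg_abs_le (∫ x, ⟪convect (w₂ s) (δ s) x, y s x⟫_ℝ)
    linarith
  -- Grönwall
  have hgr := linearisedNSForced_integral_norm_sq_le h₁.smooth_velocity h₁.divFree hy (hq₂.sub hq₁)
    hydiv hGZ hliny hC₁ le_rfl hGc0 hsrc ht
  have hy0 : ∫ x, ‖y a x‖ ^ 2 = 0 := by
    have h : ∀ x, y a x = 0 := fun x => by simp only [hy_def, h0, sub_self]
    simp only [h, norm_zero, ne_eq, OfNat.ofNat_ne_zero, not_false_eq_true, zero_pow, integral_zero]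
  rw [hy0, zero_add, add_zero] at hgr
  have hL0 : 0 ≤ ∑ i, C₁ i := Finset.sum_nonneg fun i _ => (norm_nonneg _).trans (hC₁ i a ha 0)
  have ht1 : 0 ≤ t - a := by linarith [ht.1]
  have ht2 : t - a ≤ τ := by rw [hb] at ht; linarith [ht.2]
  have hexp : Real.exp ((2 * ∑ i, C₁ i) * (t - a)) ≤ Real.exp (2 * Λ * τ) := by
    refine Real.exp_le_exp.2 ?_
    calc (2 * ∑ i, C₁ i) * (t - a) ≤ 2 * Λ * (t - a) := by gcongr
      _ ≤ 2 * Λ * τ := by gcongr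
  calc ∫ x, ‖w₂ t x - w₁ t x‖ ^ 2 = ∫ x, ‖y t x‖ ^ 2 := rfl
    _ ≤ Gc * (t - a) * Real.exp ((2 * ∑ i, C₁ i) * (t - a)) := hgr
    _ ≤ Gc * τ * Real.exp (2 * Λ * τ) := by gcongr
    _ = ν⁻¹ * (2 * (Real.sqrt K₄ * Real.sqrt Kw)) * τ * Real.exp (2 * Λ * τ) * H₀ * Ξ := by
        simp only [hGc]; ring

end Three

end Torus

end Literature.Analysis.FunctionSpaces
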